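import Mathlib
import Summits.NavierStokesRegularity.NavierStokesRegularity.Theorems.WakeRatchetAdmissibleEternalBoundOrthant
import HarnessLib

/-!
# `AdmissibleEternalBound` HOLDS on the inviscid STRONG-ORTHANT slice: admissible eternal solutions of
# pure Katz–Pavlović networks are forward cascades, hence uniformly bounded
# (support for `WakeRatchet.AdmissibleEternalBound`, stmt-NavierStokesRegularity-23197)

Companion of `WakeRatchetAdmissibleEternalBoundOrthant` (`WakeRatchetOrthant.apply_nonneg`: on a
strongly quasi-positive mode every admissible eternal solution is `≥ 0`).  Consequences drawn here
(any `ε₀ > 0`, any `ν̂ ≥ 0`, any spread, no smallness anywhere):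

* `nonneg`, `admissibleEternal_nonneg_of_quasiPositive` — admissible eternal solutions of a
  strong-orthant table live in the closed positive cone at every shell `n ∈ ℤ` and log-time;
* `physFlux_nonneg` — hence every energy flux `F_k ∝ ⟪W_{k+1}, A(W_k)⟫` is `≥ 0`: strong-orthant tables
  carry only FORWARD cascades (no backscatter, ever);
* `uniformBound_of_orthant`, `norm_le_of_orthant` — so every admissible INVISCID eternal solution of a
  cancelling strong-orthant table is `UniformBound`, `‖W_k(σ)‖ ≤ M e^{C_A M/Λ}` (energy persistence,
  `WakeRatchetPersistence.uniformBound_of_forwardCascade`); `norm_le_of_orthant_visc` — with viscosity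
  the same bound at and below the dissipation cutoff;
* `quasiPositive_iff_strongOrthant` — the hypothesis in the routes' language: ALL modes strongly
  quasi-positive ⟺ the UNCONDITIONAL Kamke condition `Y_{i,n} = 0 ⟹ quadTerm δ α Y i n ≥ 0` for every
  family `Y` (the orthant predicate of OrthantWake / SubOnsagerCeiling with its positivity premise
  dropped: pure Katz–Pavlović networks; differential feeds and cross back-reactions excluded);
* `admissibleEternalBound_inviscid_of_quasiPositive` — THE CRUX IN ITS OWN QUANTIFIER SHAPE on the slice
  {E₂(R) table with the unconditional Kamke condition, `ν̂ = 0`}, for every `R` and every `ε₀ > 0`;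
  `quasiPositive_dyadicTable`, `uniformBound_dyadic_of_quasiPositive` — non-vacuity: the dyadic member
  is in the class (recovering `WakeRatchetDyadic.uniformBound_dyadic`).

WHAT THIS LEAVES OF THE CRUX (planner information, D-0014).  (1) Every refutation of
`AdmissibleEternalBound` must use a SIGN-MIXING table (rotor gates, cross back-reactions, differential
feeds) — consistent with the landed negative lemmas, whose bounce / two-sided self-similar witnesses
need anti-symmetric or rotating structure.  (2) On the strong-orthant class only the VISCOUS HOT LAYER
is open: above the cutoff a dissipation-scale climbing chain (shell heights
`≈ (λ⁴/ΛC_A)·ν̂(1+ε₀)^{2b}e^{-σ}`, durations `≈ 1/viscCoef`, summable in `b` — an interior «whimper»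
blow-up of the viscous lattice) is consistent with every budget used here, so `UniformBound` for
VISCOUS orthant solutions is a regularity statement for the viscous Katz–Pavlović lattice below shell
ratio `2`, open in print even for the dyadic member (cf. the aside `OrthantWake.DyadicBreakBelowOne`).
MODEL lattice ODEs only (Tao 2016 §4, §6.4); nothing in this file is a statement about the
Navier–Stokes equations, and no summit or rung is proved by it.
-/

noncomputable section

set_option linter.dupNamespace false

namespace Summit.NavierStokesRegularity.NavierStokesRegularity.Theorems

namespace WakeRatchetOrthant

open Filter Topology MeasureTheory Set intervalIntegral
open scoped RealInnerProductSpace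
open Literature.Analysis.FluidPDE Literature.Analysis.FluidPDE.TaoCascade
open WakeRatchetFedSpike WakeRatchetPersistence WakeRatchetDyadic

section Consequences

variable {m : ℕ} {ε₀ νh : ℝ} {α : Fin m → Fin m → Fin m → ℤ × ℤ × ℤ → ℝ} {W : ℤ → ℝ → Em m}

/-- **Admissible eternal solutions of a strong-orthant table live in the closed positive cone**: if
EVERY mode of `α` is strongly quasi-positive (feed forms `≥ 0` on `ℝ^m`, in-shell forms `≥ 0` on the
coordinate hyperplanes, diagonal back-reaction — a pure Katz–Pavlović network), then every admissible
eternal solution (any `ν̂ ≥ 0`, any `ε₀ > 0`) is componentwise non-negative at every shell and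
log-time.  MODEL lattice only.
[cite: Tao2016AveragedNS, §1.2, §4 Lemma 4.1 (4.8), the viscous equation before Thm. 4.2, §6.4; cell vocabulary (`IsEternalVisc`)] -/
theorem nonneg (hε : 0 < ε₀) (hW : IsEternalVisc ε₀ νh α W)
    (hA : ∀ (i : Fin m) (y : Em m), 0 ≤ tableA α y i)
    (hQ : ∀ (i : Fin m) (x : Em m), x i = 0 → 0 ≤ tableQ α x i)
    (hB : ∀ (i : Fin m) (z x : Em m), x i = 0 → tableB α z x i = 0)
    (n : ℤ) (σ : ℝ) (i : Fin m) : 0 ≤ W n σ i :=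
  apply_nonneg hε hW i (hA i) (hQ i) (hB i) n σ

/-- The energy-transfer pairing `⟪w, A(y)⟫ = Σ_i w_i (A y)_i` is non-negative when `w` lies in the
positive cone and every feed component `(A y)_i` is non-negative.
[cite: Tao2016AveragedNS, §1.2 (energy flows from mode `n` to `n+1` at rate `λⁿ X_{n+1} X_n²`), §4 (4.1); folklore] -/
theorem inner_tableA_nonneg {w y : Em m} (hw : ∀ i, 0 ≤ w i) (hA : ∀ i, 0 ≤ tableA α y i) :
    0 ≤ ⟪w, tableA α y⟫ := by
  rw [PiLp.inner_apply]
  refine Finset.sum_nonneg fun i _ => ?_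
  rw [RCLike.inner_apply, conj_trivial]
  exact mul_nonneg (hA i) (hw i)

/-- **Strong-orthant tables carry only FORWARD cascades**: every energy flux
`F_k ∝ ⟪W_{k+1}, A(W_k)⟫` of an admissible eternal solution is non-negative (no backscatter ever).
[cite: Tao2016AveragedNS, §1.2, §4 Lemma 4.1 (4.9); cell vocabulary (`physFlux`)] -/
theorem physFlux_nonneg (hε : 0 < ε₀) (hW : IsEternalVisc ε₀ νh α W)
    (hA : ∀ (i : Fin m) (y : Em m), 0 ≤ tableA α y i)
    (hQ : ∀ (i : Fin m) (x : Em m), x i = 0 → 0 ≤ tableQ α x i)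
    (hB : ∀ (i : Fin m) (z x : Em m), x i = 0 → tableB α z x i = 0)
    (k : ℤ) (σ : ℝ) : 0 ≤ physFlux ε₀ α W k σ := by
  have hΛ : 0 < bigLam ε₀ := bigLam_pos (by linarith)
  have h1 : 0 ≤ ⟪W (k + 1) σ, tableA α (W k σ)⟫ :=
    inner_tableA_nonneg (fun i => nonneg hε hW hA hQ hB (k + 1) σ i) (fun i => hA i _)
  have hz : 0 ≤ (bigLam ε₀ ^ k)⁻¹ ^ 2 * (bigLam ε₀)⁻¹ := by
    have := zpow_pos hΛ k
    positivity
  unfold physFlux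
  exact mul_nonneg (mul_nonneg two_pos.le hz) (mul_nonneg (Real.exp_pos _).le h1)

/-- **`AdmissibleEternalBound` ON THE STRONG-ORTHANT CLASS, INVISCID**: on a cancelling table all of
whose modes are strongly quasi-positive (pure Katz–Pavlović network; any number of modes, any
`ε₀ > 0`, no comparability or smallness), every admissible INVISCID eternal solution is uniformly
bounded — it is non-negative (`nonneg`), hence a forward cascade (`physFlux_nonneg`), hence bounded by
energy persistence (`WakeRatchetPersistence.uniformBound_of_forwardCascade`), with constant
`M e^{C_A M/Λ}` (`norm_le_of_orthant`).  This extends `WakeRatchetDyadic.uniformBound_dyadic` from the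
dyadic member to the class; a refutation of the crux (stmt-23197) must therefore use a SIGN-MIXING
table (rotor gates, cross back-reactions, differential feeds) or the viscous hot layer.
MODEL lattice ODEs only; nothing about the Navier–Stokes equations.
[cite: Tao2016AveragedNS, §1.2, §4 Thm. 4.2 (statement shape), Lemma 4.1 (4.8)–(4.10) with (4.3), §6.4; cell vocabulary (`IsEternal`, `UniformBound`)] -/
theorem uniformBound_of_orthant (hε : 0 < ε₀) (hc : IsCancellingCoeff α) (hW : IsEternal ε₀ α W)
    (hA : ∀ (i : Fin m) (y : Em m), 0 ≤ tableA α y i)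
    (hQ : ∀ (i : Fin m) (x : Em m), x i = 0 → 0 ≤ tableQ α x i)
    (hB : ∀ (i : Fin m) (z x : Em m), x i = 0 → tableB α z x i = 0) :
    UniformBound W :=
  uniformBound_of_forwardCascade hε hc hW (physFlux_nonneg hε hW.isEternalVisc hA hQ hB)

/-- Explicit constant on the strong-orthant class (inviscid): `‖W_k(σ)‖ ≤ M e^{C_A M/Λ}` for any
per-shell action bound `M`. [cite: Tao2016AveragedNS, §4 Lemma 4.1 (4.8)–(4.10), §6.4; cell vocabulary] -/
theorem norm_le_of_orthant (hε : 0 < ε₀) (hc : IsCancellingCoeff α) (hW : IsEternal ε₀ α W)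
    {M : ℝ} (hM : ∀ n : ℤ, Integrable (fun σ => ‖W n σ‖) ∧ ∫ σ, ‖W n σ‖ ≤ M)
    (hA : ∀ (i : Fin m) (y : Em m), 0 ≤ tableA α y i)
    (hQ : ∀ (i : Fin m) (x : Em m), x i = 0 → 0 ≤ tableQ α x i)
    (hB : ∀ (i : Fin m) (z x : Em m), x i = 0 → tableB α z x i = 0) (k : ℤ) (σ : ℝ) :
    ‖W k σ‖ ≤ M * Real.exp (fluxConst α * (bigLam ε₀)⁻¹ * M) :=
  norm_le_of_forwardCascade hε hc hW hM (physFlux_nonneg hε hW.isEternalVisc hA hQ hB) k σ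

/-- **Viscous strong-orthant tables: the bound at and below the dissipation cutoff.**  With covariant
viscosity `ν̂ ≥ 0`, `‖W_b(σ₀)‖ ≤ M exp(C_A M/Λ + viscCoef(b, σ₀))` at every shell and log-time (all
fluxes are forward by `physFlux_nonneg`); uniform wherever `viscCoef(b, σ₀) = ν̂(1+ε₀)^{2b}e^{-σ₀}` is
bounded.  The layer above the cutoff is NOT bounded here (see the module docstring: a
dissipation-scale climbing chain is budget-consistent).
[cite: Tao2016AveragedNS, §4, the viscous equation before Thm. 4.2, Lemma 4.1 (4.8)–(4.10), §6.4; cell vocabulary] -/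
theorem norm_le_of_orthant_visc (hε : 0 < ε₀) (hc : IsCancellingCoeff α) (hW : IsEternalVisc ε₀ νh α W)
    {M : ℝ} (hM : ∀ n : ℤ, Integrable (fun σ => ‖W n σ‖) ∧ ∫ σ, ‖W n σ‖ ≤ M)
    (hA : ∀ (i : Fin m) (y : Em m), 0 ≤ tableA α y i)
    (hQ : ∀ (i : Fin m) (x : Em m), x i = 0 → 0 ≤ tableQ α x i)
    (hB : ∀ (i : Fin m) (z x : Em m), x i = 0 → tableB α z x i = 0) (b : ℤ) (σ₀ : ℝ) :
    ‖W b σ₀‖ ≤ M * Real.exp (fluxConst α * (bigLam ε₀)⁻¹ * M + viscCoef ε₀ νh b σ₀) :=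
  norm_le_of_forwardFlux hε hc hW hM b σ₀ (fun σ _ => physFlux_nonneg hε hW hA hQ hB (b - 1) σ)

end Consequences

/-! ## The strong-orthant condition in the route's `quadTerm` language

The routes OrthantWake / SubOnsagerCeiling call `α` an ORTHANT table when the cascade nonlinearity is
quasi-positive on the cone `{Y ≥ 0 on shells ≥ 1}` (a CONDITIONAL Kamke condition).  The hypothesis
of this file is the UNCONDITIONAL Kamke condition — `Y_{i,n} = 0 ⟹ quadTerm δ α Y i n ≥ 0` with NO
sign assumption on the other entries — and `quasiPositive_iff_strongOrthant` identifies it with the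
three coefficient conditions used above. -/

section QuadTerm

variable {m : ℕ}

/-- The table maps vanish at zero / are homogeneous (finite algebra).
[cite: Tao2016AveragedNS, §4 (4.1); folklore] -/
theorem tableQ_zero (α : Fin m → Fin m → Fin m → ℤ × ℤ × ℤ → ℝ) (i : Fin m) : tableQ α 0 i = 0 := by
  rw [tableQ_apply]; unfold qform; simp

/-- [cite: Tao2016AveragedNS, §4 (4.1); folklore] -/
theorem tableA_zero (α : Fin m → Fin m → Fin m → ℤ × ℤ × ℤ → ℝ) (i : Fin m) : tableA α 0 i = 0 := by
  rw [tableA_apply]; unfold qform; simp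

/-- [cite: Tao2016AveragedNS, §4 (4.1); folklore] -/
theorem tableB_zero_left (α : Fin m → Fin m → Fin m → ℤ × ℤ × ℤ → ℝ) (x : Em m) (i : Fin m) :
    tableB α 0 x i = 0 := by
  rw [tableB_apply]; unfold qform; simp

/-- [cite: Tao2016AveragedNS, §4 (4.1); folklore] -/
theorem tableB_smul_left (α : Fin m → Fin m → Fin m → ℤ × ℤ × ℤ → ℝ) (t : ℝ) (z x : Em m) (i : Fin m) :
    tableB α (t • z) x i = t * tableB α z x i := by
  rw [tableB_apply, tableB_apply, qform_smul_left, qform_smul_right]; ring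

/-- A test family on three shells: shell `0` carries `x`, shell `1` carries `z`, shell `-1` carries `y`.
[cite: Tao2016AveragedNS, §4 Lemma 4.1 (the amplitudes `X_{i,n}`); folklore] -/
theorem shellVec_testFamily (y x z : Em m) (τ : ℝ) :
    (shellVec (fun j k (_ : ℝ) => if k = 0 then x j else if k = 1 then z j else if k = -1 then y j else 0)
        0 τ = x) ∧
    (shellVec (fun j k (_ : ℝ) => if k = 0 then x j else if k = 1 then z j else if k = -1 then y j else 0)
        (0 + 1) τ = z) ∧
    (shellVec (fun j k (_ : ℝ) => if k = 0 then x j else if k = 1 then z j else if k = -1 then y j else 0)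
        (0 - 1) τ = y) := by
  refine ⟨?_, ?_, ?_⟩ <;> ext j <;> simp [shellVec_apply]

/-- **Unconditional Kamke ⟺ strong orthant.**  For a table `α` on `m` modes the following are
equivalent: (i) for every family `Y` (NO sign condition), every `δ > 0` and every mode `(i, n)` with
`Y_{i,n} = 0`, the cascade nonlinearity `quadTerm δ α Y i n` is `≥ 0`; (ii) every feed component
`(A y)_i` is `≥ 0` on `ℝ^m`, every in-shell component `(Q x)_i` is `≥ 0` on `{x_i = 0}`, and every
back-reaction component `(B(z, x))_i` vanishes on `{x_i = 0}`.  ((i) drops the premise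
«`Y ≥ 0` on shells `≥ 1`» from the routes' orthant predicate; it excludes differential feeds and cross
back-reactions but keeps every pure Katz–Pavlović network.)
[cite: Tao2016AveragedNS, §4 (4.1), Lemma 4.1 (4.8); cell vocabulary (`quadTerm`, `tableQ`/`tableA`/`tableB`)] -/
theorem quasiPositive_iff_strongOrthant (α : Fin m → Fin m → Fin m → ℤ × ℤ × ℤ → ℝ) :
    (∀ (Y : Fin m → ℤ → ℝ → ℝ) (τ δ : ℝ), 0 < δ → ∀ (i : Fin m) (n : ℤ), Y i n τ = 0 →
        0 ≤ quadTerm δ α Y i n τ) ↔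
    ((∀ (i : Fin m) (y : Em m), 0 ≤ tableA α y i) ∧
      (∀ (i : Fin m) (x : Em m), x i = 0 → 0 ≤ tableQ α x i) ∧
      (∀ (i : Fin m) (z x : Em m), x i = 0 → tableB α z x i = 0)) := by
  constructor
  · intro hK
    -- evaluate the condition on the test family at shell `0`, `δ = 1`
    have key : ∀ (y x z : Em m) (i : Fin m), x i = 0 →
        0 ≤ tableQ α x i + tableB α z x i + (1 + 1 : ℝ) ^ ((5 : ℝ) * (((0 : ℤ) : ℝ) - 1) / 2) * tableA α y i := by
      intro y x z i hxi
      set Y : Fin m → ℤ → ℝ → ℝ :=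
        fun j k _ => if k = 0 then x j else if k = 1 then z j else if k = -1 then y j else 0 with hY
      obtain ⟨h0, h1, hm1⟩ := shellVec_testFamily y x z 0
      have hYi : Y i 0 0 = 0 := by simp [hY, hxi]
      have h := hK Y 0 1 one_pos i 0 hYi
      rw [quadTerm_eq_tables, h0, h1, hm1] at h
      simpa using h
    refine ⟨fun i y => ?_, fun i x hxi => ?_, fun i z x hxi => ?_⟩
    · have h := key y 0 0 i rfl
      rw [tableQ_zero, tableB_zero_left, zero_add, zero_add] at h
      have hw : 0 < (1 + 1 : ℝ) ^ ((5 : ℝ) * (((0 : ℤ) : ℝ) - 1) / 2) := Real.rpow_pos_of_pos (by norm_num) _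
      exact (mul_nonneg_iff_of_pos_left hw).1 h
    · have h := key 0 x 0 i hxi
      rwa [tableB_zero_left, tableA_zero, mul_zero, add_zero, add_zero] at h
    · -- `0 ≤ (Q x)_i + t (B(z,x))_i` for every real `t` forces `(B(z,x))_i = 0`
      have h : ∀ t : ℝ, 0 ≤ tableQ α x i + t * tableB α z x i := by
        intro t
        have := key 0 x (t • z) i hxi
        rwa [tableA_zero, mul_zero, add_zero, tableB_smul_left] at this
      by_contra hb
      have h1 := h ((-(tableQ α x i) - 1) / tableB α z x i)
      rw [div_mul_cancel₀ _ hb] at h1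
      linarith
  · rintro ⟨hA, hQ, hB⟩ Y τ δ hδ i n hYi
    have hx : shellVec Y n τ i = 0 := by rw [shellVec_apply]; exact hYi
    rw [quadTerm_eq_tables, hB _ _ _ hx, mul_zero, add_zero]
    have h1 : 0 < (1 + δ) ^ ((5 : ℝ) * n / 2) := Real.rpow_pos_of_pos (by linarith) _
    have h2 : 0 < (1 + δ) ^ ((5 : ℝ) * ((n : ℝ) - 1) / 2) := Real.rpow_pos_of_pos (by linarith) _
    exact add_nonneg (mul_nonneg h1.le (hQ _ _ hx)) (mul_nonneg h2.le (hA _ _))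

end QuadTerm

/-! ## The crux on the strong-orthant slice, in its own quantifier shape -/

/-- **Admissible eternal solutions of strong-orthant E₂(R) tables are NON-NEGATIVE** (any `ν̂ ≥ 0`,
any `ε₀ > 0`, any spread) — the positive-cone statement for ETERNAL solutions (compare the routes'
`OrthantInvariance`, which is forward invariance from a one-shell datum; here there is no datum and
the conclusion holds on every shell `n ∈ ℤ`).  Hypothesis: the unconditional Kamke condition
(`quasiPositive_iff_strongOrthant`).  MODEL lattice only; nothing about NS.
[cite: Tao2016AveragedNS, §4 Thm. 4.2 (statement shape), Lemma 4.1 (4.8), §6.4; cell vocabulary (`IsEternalVisc`)] -/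
theorem admissibleEternal_nonneg_of_quasiPositive :
    ∀ ε₀ : ℝ, 0 < ε₀ → ∀ α : Fin 4 → Fin 4 → Fin 4 → ℤ × ℤ × ℤ → ℝ,
      (∀ (Y : Fin 4 → ℤ → ℝ → ℝ) (τ δ : ℝ), 0 < δ → ∀ (i : Fin 4) (n : ℤ), Y i n τ = 0 →
          0 ≤ quadTerm δ α Y i n τ) →
        ∀ (νh : ℝ) (W : ℤ → ℝ → Em 4), IsEternalVisc ε₀ νh α W →
          ∀ (n : ℤ) (σ : ℝ) (i : Fin 4), 0 ≤ W n σ i := by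
  intro ε₀ hε α hK νh W hW n σ i
  obtain ⟨hA, hQ, hB⟩ := (quasiPositive_iff_strongOrthant α).1 hK
  exact nonneg hε hW hA hQ hB n σ i

/-- **`AdmissibleEternalBound` HOLDS on the inviscid strong-orthant slice** — in the crux's own
quantifier shape (stmt-NavierStokesRegularity-23197), with NO threshold on `ε₀` and for every spread:
for every E₂(R) table satisfying the unconditional Kamke condition (pure Katz–Pavlović networks) and
every admissible INVISCID eternal solution, `UniformBound W`.  What this leaves of the crux: sign-mixing
tables (where the landed negative lemmas `…FalseOfSymmetricDSSWaves` / `…FalseOfGlobalSelfSimilarProfiles`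
place the expected counterexamples) and, on the orthant class itself, the viscous layer above the
dissipation cutoff.  MODEL lattice only; nothing about the Navier–Stokes equations; no summit or rung
is proved.
[cite: Tao2016AveragedNS, §1.2, §4 Thm. 4.2 (statement shape), Lemma 4.1 (4.8)–(4.10), §6.4; cell vocabulary (`IsEternal`, `UniformBound`, `quadTerm`)] -/
theorem admissibleEternalBound_inviscid_of_quasiPositive :
    ∀ R : ℝ, 1 ≤ R → ∀ ε₀ : ℝ, 0 < ε₀ →
      ∀ α : Fin 4 → Fin 4 → Fin 4 → ℤ × ℤ × ℤ → ℝ, InTableClass R α →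
        (∀ (Y : Fin 4 → ℤ → ℝ → ℝ) (τ δ : ℝ), 0 < δ → ∀ (i : Fin 4) (n : ℤ), Y i n τ = 0 →
            0 ≤ quadTerm δ α Y i n τ) →
          ∀ W : ℤ → ℝ → Em 4, IsEternal ε₀ α W → UniformBound W := by
  intro R _hR ε₀ hε α hα hK W hW
  obtain ⟨hA, hQ, hB⟩ := (quasiPositive_iff_strongOrthant α).1 hK
  exact uniformBound_of_orthant hε hα.2.1 hW hA hQ hB

/-! ## Non-vacuity: the dyadic member is a strong-orthant table -/

/-- **The dyadic member satisfies the unconditional Kamke condition**: off component `0` its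
nonlinearity vanishes, and on component `0` it is `λ^{5(n-1)/2} X_{0,n-1}² − λ^{5n/2} X_{0,n}X_{0,n+1}`,
which is `≥ 0` as soon as `X_{0,n} = 0` — whatever the signs of the other entries.  Hence every
theorem of this file applies to `dyadicTable` (recovering `WakeRatchetDyadic.dyadic_nonneg` /
`uniformBound_dyadic`).
[cite: Tao2016AveragedNS, §1.2 (the dyadic Katz–Pavlović system), §4 (4.4); cell vocabulary (`dyadicTable`, `quadTerm`)] -/
theorem quasiPositive_dyadicTable :
    ∀ (Y : Fin 4 → ℤ → ℝ → ℝ) (τ δ : ℝ), 0 < δ → ∀ (i : Fin 4) (n : ℤ), Y i n τ = 0 →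
      0 ≤ quadTerm δ dyadicTable Y i n τ := by
  intro Y τ δ hδ i n hY
  by_cases hi : i = 0
  · subst hi
    rw [quadTerm_dyadicTable_zero, hY, zero_mul, mul_zero, sub_zero]
    exact mul_nonneg (Real.rpow_pos_of_pos (by linarith) _).le (sq_nonneg _)
  · rw [quadTerm_dyadicTable_of_ne δ Y hi]

/-- The dyadic member as an instance of the slice: every admissible inviscid eternal solution of
`dyadicTable` is uniformly bounded (any `ε₀ > 0`; `dyadicTable ∈ InTableClass 2`).
[cite: Tao2016AveragedNS, §1.2, §4 Thm. 4.2 (statement shape), §6.4; cell vocabulary] -/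
theorem uniformBound_dyadic_of_quasiPositive {ε₀ : ℝ} (hε : 0 < ε₀) {W : ℤ → ℝ → Em 4}
    (hW : IsEternal ε₀ dyadicTable W) : UniformBound W :=
  admissibleEternalBound_inviscid_of_quasiPositive 2 (by norm_num) ε₀ hε dyadicTable
    (inTableClass_dyadicTable le_rfl) quasiPositive_dyadicTable W hW


end WakeRatchetOrthant

end Summit.NavierStokesRegularity.NavierStokesRegularity.Theorems

end
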